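import Summits.BirchSwinnertonDyer.BirchSwinnertonDyer.Theorems.ErratumRoadFiveBoundedCongruenceLimit
import Literature.NumberTheory.EllipticCurves.IwasawaAlgebraCharIdealProofs
import Mathlib.Algebra.Polynomial.Div
import Mathlib.Algebra.BigOperators.Associated
import HarnessLib

/-!
# Route `ErratumRoadFive` (K2), crux (T) `Rest3TorsionBranchAtFive` (item stmt-BirchSwinnertonDyer-19702):
# the `μ = 0` TRANSFER through an IMPRIMITIVE congruence — the input `π ∤ L_𝔭(f)` of the (iv)-free
# erratum road (THEOREM T♭, memo §31.3 step (7)) from the erratum's statement (c) EXACTLY AS PRINTED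
# (fixed `Σ ⊇ {v ∣ M}`), by an analysis of the `Λ`-adic Euler factors at `w ∈ Σ` (memo §33, step (7′))

Cell `bsd-stepL` (run/shared/lean/pub/bsd-stepL/), seat `bsd-stepL-bdp` (prover g15, 2026-08-27), memo
`HOME/proof/PROOF-BDP.md` §33; `--supports stmt-BirchSwinnertonDyer-19702 --as helper`. Answers referee
g33's GAP(l.2151) on memo §31 (VERDICT-BDP-S31-g33.md, R31-4): step (7) there consumed «(c) at `m = 1`
and `Σ = ∅`», which the erratum does not print; step (7′) consumes ONE inclusion of (c) at ONE level
`m` with `e·m > t` at the erratum's own `Σ`.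

HONEST FRAMING: PURE COMMUTATIVE ALGEBRA (theorems only; no definition, no named fact, no `sorry`); the
binders are abstract ring elements and modules — that they are instantiated by `L^Σ_𝔭(f)`, `L^Σ_𝔭(g_m)`,
the Euler factors `P_w` of [Cas18, (3.1)] and the dual Selmer groups is NOT asserted here (objects absent
from the tree); nothing is booked; BSD is advanced for no class; no census word, tier or label moves (T7).

## The mathematics (memo §33)

[Cas18, (3.1)] DEFINES `L^Σ_𝔭(h) := L_𝔭(h) · ∏_{w ∈ Σ} P_w(h)` with
`P_w(h) = det(1 − X·Frob_w | V_h^{I_w})|_{X = ε(Frob_w)·γ_w^{-1}} ∈ Λ`, `γ_w` the image of `Frob_w` in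
the anticyclotomic `Γ ≅ ℤ_p`. Under the generalised Heegner hypothesis the primes `w ∣ M` of `K` are
either SPLIT (`γ_w ≠ 1`, since split primes are finitely decomposed in `K_∞^{ac}/K`; then
`P_w = Q_w(u·γ_w^{-1})` with `Q_w(0) = 1` is a NON-CONSTANT substitution and has `μ = 0`, §2) or
RAMIFIED (`γ_𝔮 = 1`; then `P_𝔮 ∈ 𝒪` is a non-zero CONSTANT, `= 1 + q⁻¹` for `f` and — by the
erratum's own footnote 1, rigidity of automorphic types [FO12, Lem. 2.14] — for every `g_m`; it is a
non-unit iff `p ∣ q + 1`). Writing `L^Σ(h) = L(h) · C · E(h)` (`C = ∏_𝔮 P_𝔮 = ϖ^t·unit`,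
`E(h) = ∏_{w split} P_w(h)` with `ϖ ∤ E(h)`), ONE inclusion of (c),
`L^Σ(g_m) ∈ (L^Σ(f)) + (ϖ^{em})` with `em > t`, gives after cancelling `ϖ^t` in the domain `Λ`:
`L(g_m)·u·E(g_m) ≡ λ·L(f)·u'·E(f) (mod ϖ)`; so `ϖ ∣ L(f)` would force `ϖ ∣ L(g_m)·u·E(g_m)`, i.e.
(`ϖ` prime in `Λ`) `ϖ ∣ L(g_m)` — contradicting [Hsi14, Thm. B] for `g_m`, which the erratum already
invokes for every `g_m` (p. 4) — or `ϖ ∣ u·E(g_m)`, contradicting §2 (§1, §4). §3 records the end form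
of T♭ with the Σ-removal performed BEFORE the cancellation (memo §31.3 (6) then (8)), whose input
`hL : π ∤ L` is the PRIMITIVE `μ = 0` supplied by §1.

Dictionary: `R = Λ = 𝒪⟦T⟧` (`𝒪 = 𝒪^{ur}` a complete DVR; `π = C ϖ`, prime in `Λ` by
`prime_C_of_prime`), `L = L_𝔭(f)`, `Lm = L_𝔭(g_m)`, `C`/`Cm` = the ramified constants,
`E`/`Em` = the split Euler products, `d = p^m` (`π^{em}` up to a unit), `Q = Q_w ∈ 𝒪[X]` with
`Q(0) = 1`, `z = u·γ_w^{-1} ∈ Λ` non-constant modulo `ϖ`.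

References: [Castella2018Erratum] proof of Thm. 1.1 (c) and footnote 1 (p. 4); [Castella2018] (3.1)
(arXiv:1704.06608 p. 9); [JetchevSkinnerWan2017] §3.4 (the display defining `L^Σ_p(f)`, Remark after it)
and Cor. 3.4.2; [Hsieh2014] Thm. B; memo §31.3, §33.
-/

set_option autoImplicit false
-- the Theorems namespace of this sub repeats the summit name by design (D-0017 nested layout)
set_option linter.dupNamespace false

noncomputable section

open Literature.RingTheory.FittingIdeal Literature.NumberTheory.EllipticCurves
  Literature.NumberTheory.EllipticCurves.Module PowerSeries IsDiscreteValuationRing IsLocalRing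
  Summit.BirchSwinnertonDyer.Rank1Residual.X11b.CongruenceLimit

namespace Summit.BirchSwinnertonDyer.BirchSwinnertonDyer.Theorems.MuTransfer

open Summit.BirchSwinnertonDyer.BirchSwinnertonDyer.Theorems.BoundedCongruenceLimit

universe u

/-! ### §1 `μ = 0` transfer through ONE inclusion of an imprimitive congruence (any domain) -/

section Transfer

variable {R : Type u} [CommRing R] [IsDomain R] {π : R}

/-- **`μ = 0` TRANSFER THROUGH AN IMPRIMITIVE CONGRUENCE (memo §33 (7′)).** In a domain with a prime
`π`: if `Lm·Cm·Em ∈ (L·C·E) + (d)` (ONE inclusion of the erratum's (c) at level `Σ`, `d = p^m`),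
`π^{t+1} ∣ d`, the constant `Cm = π^t·u` with `π ∤ u`, `π^t ∣ C`, and `π ∤ Lm` (Hsieh's `μ = 0` for
`g_m`), `π ∤ Em` (split Euler factors, §2), THEN `π ∤ L` — the PRIMITIVE `μ(L_𝔭(f)) = 0`. No
congruence between `C` and `Cm`, or `E` and `Em`, is used. [cite: Castella2018Erratum, proof of Thm. 1.1, (c) (p. 4)]
[cite: Hsieh2014, Thm. B (the input `π ∤ Lm`)] -/
theorem not_dvd_of_imprimitive_congruence (hπ : Prime π) {L Lm C Cm E Em d u : R} {t : ℕ}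
    (hc : Lm * Cm * Em ∈ Ideal.span {L * C * E} ⊔ Ideal.span {d}) (hd : π ^ (t + 1) ∣ d)
    (hCm : Cm = π ^ t * u) (hu : ¬ π ∣ u) (hC : π ^ t ∣ C) (hLm : ¬ π ∣ Lm) (hEm : ¬ π ∣ Em) :
    ¬ π ∣ L := by
  intro hL
  obtain ⟨x, hx, y, hy, hxy⟩ := Submodule.mem_sup.mp hc
  obtain ⟨a, rfl⟩ := Ideal.mem_span_singleton'.mp hx
  obtain ⟨b, rfl⟩ := Ideal.mem_span_singleton'.mp hy
  obtain ⟨C', rfl⟩ := hC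
  obtain ⟨d', rfl⟩ := hd
  obtain ⟨L', rfl⟩ := hL
  subst hCm
  have key : π ^ t * (π * (a * L' * C' * E + b * d')) = π ^ t * (Lm * u * Em) := by
    linear_combination hxy
  have h2 : π * (a * L' * C' * E + b * d') = Lm * u * Em :=
    mul_left_cancel₀ (pow_ne_zero _ hπ.ne_zero) key
  have h3 : π ∣ Lm * u * Em := ⟨_, h2.symm⟩
  rcases hπ.dvd_or_dvd h3 with h4 | h4
  · rcases hπ.dvd_or_dvd h4 with h5 | h5
    · exact hLm h5
    · exact hu h5
  · exact hEm h4

/-- **The same with (c) as the printed EQUALITY of ideals** `(L^Σ(g_m)) + J = (L^Σ(f)) + J`,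
`J ⊆ (d)` (e.g. `J = I^m`, `I = (p)` or `(ϖ)`): only the inclusion `⊆` is consumed.
[cite: Castella2018Erratum, proof of Thm. 1.1, (c) (p. 4)] -/
theorem not_dvd_of_imprimitive_congruence_eq (hπ : Prime π) {L Lm C Cm E Em d u : R} {t : ℕ}
    {J : Ideal R} (hc : Ideal.span {Lm * Cm * Em} ⊔ J = Ideal.span {L * C * E} ⊔ J)
    (hJ : J ≤ Ideal.span {d}) (hd : π ^ (t + 1) ∣ d)
    (hCm : Cm = π ^ t * u) (hu : ¬ π ∣ u) (hC : π ^ t ∣ C) (hLm : ¬ π ∣ Lm) (hEm : ¬ π ∣ Em) :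
    ¬ π ∣ L := by
  have hmem : Lm * Cm * Em ∈ Ideal.span {Lm * Cm * Em} ⊔ J :=
    Ideal.mem_sup_left (Ideal.mem_span_singleton_self _)
  rw [hc] at hmem
  exact not_dvd_of_imprimitive_congruence hπ (sup_le_sup_left hJ _ hmem) hd hCm hu hC hLm hEm

omit [IsDomain R] in
/-- **The modulus `I^m` qualifies once `m > t`**: `(π)^m ⊆ (π^{t+1})` for `t + 1 ≤ m`. [folklore] -/
theorem span_singleton_pow_le_of_le {m t : ℕ} (hm : t + 1 ≤ m) :
    (Ideal.span {π}) ^ m ≤ Ideal.span {π ^ (t + 1)} := by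
  rw [Ideal.span_singleton_pow, Ideal.span_singleton_le_span_singleton]
  exact pow_dvd_pow π hm

/-- **DESCENT of (c) through a common non-zero constant** (memo §33 remark): in a domain, for `c ≠ 0`,
`(c·B) + (c·D) = (c·A) + (c·D) ↔ (B) + (D) = (A) + (D)`. With `c = C = ∏_𝔮 P_𝔮` (the same ramified
constant for `f` and every `g_m`) and `p^m = c·D`, the printed (c) at `Σ ⊇ {v ∣ M}` is EQUIVALENT to (c)
at the split part `Σ_s` with modulus `p^m/C`: a full system of congruences again. [folklore] -/
theorem span_mul_sup_span_mul_eq_iff {c A B D : R} (hc : c ≠ 0) :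
    Ideal.span {c * B} ⊔ Ideal.span {c * D} = Ideal.span {c * A} ⊔ Ideal.span {c * D} ↔
      Ideal.span {B} ⊔ Ideal.span {D} = Ideal.span {A} ⊔ Ideal.span {D} := by
  have key : ∀ X Y : R, Ideal.span {c * X} ⊔ Ideal.span {c * Y} =
      Ideal.span {c} * (Ideal.span {X} ⊔ Ideal.span {Y}) := fun X Y => by
    rw [Ideal.mul_sup, Ideal.span_singleton_mul_span_singleton, Ideal.span_singleton_mul_span_singleton]
  rw [key, key]
  exact Ideal.span_singleton_mul_right_inj hc

end Transfer

/-! ### §2 Euler factors at finitely decomposed places have `μ = 0` (reduction modulo `ϖ`) -/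

section EulerFactor

/-- `C π ∣ f` in `A⟦T⟧` iff `f ↦ 0` in `(A/π)⟦T⟧` (coefficientwise divisibility). [folklore] -/
theorem C_dvd_iff_map_eq_zero {A : Type u} [CommRing A] (π : A) (f : PowerSeries A) :
    PowerSeries.C π ∣ f ↔ PowerSeries.map (Ideal.Quotient.mk (Ideal.span {π})) f = 0 := by
  rw [PowerSeries.ext_iff]
  simp only [PowerSeries.coeff_map, map_zero, Ideal.Quotient.eq_zero_iff_mem,
    Ideal.mem_span_singleton]
  constructor
  · rintro ⟨g, rfl⟩ n
    exact ⟨PowerSeries.coeff n g, by rw [PowerSeries.coeff_C_mul]⟩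
  · intro h
    choose c hc using h
    exact ⟨PowerSeries.mk c, by ext n; rw [PowerSeries.coeff_C_mul, PowerSeries.coeff_mk, hc]⟩

/-- **A non-zero polynomial does not vanish at a NON-CONSTANT power series** (over a domain `F`):
write `Q = (X − c)^n · Q₂` with `Q₂(c) ≠ 0`, `c = z(0)`; then `Q(z) = (z − c)^n · Q₂(z)` with
`z − c ≠ 0` and `Q₂(z)(0) = Q₂(c) ≠ 0`. (For the anticyclotomic Euler factor `P_w = Q_w(u·γ_w^{-1})`
at a SPLIT `w`: `γ_w ≠ 1` in `Γ`, so the substituted series is non-constant modulo `ϖ`.) [folklore] -/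
theorem aeval_ne_zero_of_ne_C {F : Type u} [CommRing F] [IsDomain F] {Q : Polynomial F} (hQ : Q ≠ 0)
    {z : PowerSeries F} (hz : z ≠ PowerSeries.C (PowerSeries.constantCoeff z)) :
    Polynomial.aeval z Q ≠ 0 := by
  set c := PowerSeries.constantCoeff z with hc
  have hsplit := Polynomial.pow_mul_divByMonic_rootMultiplicity_eq Q c
  set n := Polynomial.rootMultiplicity c Q
  set Q₂ := Q /ₘ (Polynomial.X - Polynomial.C c) ^ n
  have hQ₂ : Polynomial.eval c Q₂ ≠ 0 := Polynomial.eval_divByMonic_pow_rootMultiplicity_ne_zero c hQ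
  have hfac : Polynomial.aeval z Q = (z - PowerSeries.C c) ^ n * Polynomial.aeval z Q₂ := by
    conv_lhs => rw [← hsplit]
    simp only [map_mul, map_pow, map_sub, Polynomial.aeval_X, Polynomial.aeval_C,
      PowerSeries.C_eq_algebraMap]
  have h0 : PowerSeries.constantCoeff (Polynomial.aeval z Q₂) = Polynomial.eval c Q₂ := by
    rw [Polynomial.aeval_def, Polynomial.hom_eval₂]
    have hcomp : (PowerSeries.constantCoeff (R := F)).comp (algebraMap F (PowerSeries F)) =
        RingHom.id F := by
      ext a
      simp
    rw [hcomp]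
    rfl
  have h1 : Polynomial.aeval z Q₂ ≠ 0 := by
    intro h
    apply hQ₂
    rw [← h0, h, map_zero]
  have h2 : z - PowerSeries.C c ≠ 0 := sub_ne_zero.mpr hz
  rw [hfac]
  exact mul_ne_zero (pow_ne_zero _ h2) h1

/-- **`ϖ ∤ Q(z)` in `𝒪⟦T⟧` when `ϖ ∤ Q(0)` and `z` is non-constant modulo `ϖ`** — the `μ = 0` of the
`Λ`-adic Euler factor `P_w = Q_w(u·γ_w^{-1})` ([Cas18, (3.1)], [JSW17, §3.4]: `Q_w(X) =
det(1 − X·Frob_w | V^{I_w})`, `Q_w(0) = 1`) at a place `w` FINITELY DECOMPOSED in the anticyclotomic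
tower (every split `w`); at inert or ramified `w` (`γ_w = 1`) the factor is a constant and this does
not apply ([JSW17, Remark after the definition of `L^Σ_p(f)`]). [cite: Castella2018, (3.1) (arXiv:1704.06608 p. 9)]
[cite: JetchevSkinnerWan2017, §3.4 (definition of the incomplete L-function and the Remark after it)] -/
theorem not_C_dvd_aeval {A : Type u} [CommRing A] {π : A} (hπ : Prime π) {Q : Polynomial A}
    (hQ : ¬ π ∣ Q.coeff 0) {z : PowerSeries A}
    (hz : PowerSeries.map (Ideal.Quotient.mk (Ideal.span {π})) z ≠
      PowerSeries.C (PowerSeries.constantCoeff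
        (PowerSeries.map (Ideal.Quotient.mk (Ideal.span {π})) z))) :
    ¬ PowerSeries.C π ∣ Polynomial.aeval z Q := by
  haveI hprime : (Ideal.span {π}).IsPrime := (Ideal.span_singleton_prime hπ.ne_zero).mpr hπ
  haveI : IsDomain (A ⧸ Ideal.span {π}) := (Ideal.Quotient.isDomain_iff_prime _).mpr hprime
  rw [C_dvd_iff_map_eq_zero]
  set mk := Ideal.Quotient.mk (Ideal.span {π})
  have hsq : (algebraMap (A ⧸ Ideal.span {π}) (PowerSeries (A ⧸ Ideal.span {π}))).comp mk =
      (PowerSeries.map mk).comp (algebraMap A (PowerSeries A)) := by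
    ext a
    simp [PowerSeries.map_C, mk]
  rw [Polynomial.map_aeval_eq_aeval_map hsq]
  refine aeval_ne_zero_of_ne_C ?_ hz
  intro h
  apply hQ
  have h0 : (Q.map mk).coeff 0 = 0 := by rw [h, Polynomial.coeff_zero]
  rwa [Polynomial.coeff_map, Ideal.Quotient.eq_zero_iff_mem, Ideal.mem_span_singleton] at h0

/-- **A finite product of factors with `μ = 0` has `μ = 0`** (`π` prime). [folklore] -/
theorem not_dvd_finsetProd_of_forall {R : Type u} [CommRing R] {π : R} (hπ : Prime π)
    {ι : Type*} (S : Finset ι) {g : ι → R} (hS : ∀ i ∈ S, ¬ π ∣ g i) : ¬ π ∣ ∏ i ∈ S, g i :=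
  hπ.not_dvd_finsetProd hS

end EulerFactor

/-! ### §3 The end form of T♭ with Σ-removal BEFORE cancellation (memo §31.3 (1)–(6), (8)) -/

section EndFormSigma

open Summit.BirchSwinnertonDyer.Rank1Residual.X11b.CongruenceLimit.PowerSeriesDVR

variable {𝒪 : Type} [CommRing 𝒪] [IsDomain 𝒪] [IsDiscreteValuationRing 𝒪]
  [IsAdicComplete (maximalIdeal 𝒪) 𝒪]

/-- **`Ch_Λ(X_ac) ⊆ (L_𝔭(f))` from the IMPRIMITIVE congruence road with a bounded defect, the
Σ-removal inserted BEFORE the cancellation** (memo §31.3 in the printed order (1)–(6), (8)). Inputs at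
level `Σ` (where the erratum prints (b), (c), (2.5), Lemma 2.1): `α`, `hα`, `hD`, `hCh`, `hc` for the
Σ-imprimitive objects `MS = X^Σ`, `LS = L^Σ_𝔭(f)`, exactly as in
`BoundedCongruenceLimit.charIdeal_le_span_of_congruences_defect`; Σ-removal: `LS = L·P` [Cas18 (3.1),
by definition], `P ≠ 0`, and `Ch(X)·(P) ⊆ Ch(X^Σ)` [JSW17 Cor. 3.4.2, one inclusion]; `X`, `X^Σ` torsion
without non-zero finite submodules; and the PRIMITIVE `μ = 0`: `π ∤ L` (§1). THEN `Ch_Λ(X) ⊆ (L)`. The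
point: `π ∣ P` is allowed (ramified `𝔮 ∈ Σ` with `p ∣ q + 1`), so the cancellation cannot be run at
level `Σ`. Pure algebra; CONDITIONAL on nothing; deletes nothing.
[cite: Castella2018Erratum, proof of Thm. 1.1 (p. 4), read one-sidedly and without (iv)]
[cite: JetchevSkinnerWan2017, Cor. 3.4.2 (Σ-removal on the Selmer side)]
[cite: Castella2018, (3.1) (Σ-removal on the analytic side, by definition)] -/
theorem charIdeal_le_span_of_congruences_defect_imprimitive
    {MS : Type} [AddCommGroup MS] [Module (PowerSeries 𝒪) MS] [Module.Finite (PowerSeries 𝒪) MS]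
    {M₀ : Type} [AddCommGroup M₀] [Module (PowerSeries 𝒪) M₀] [Module.Finite (PowerSeries 𝒪) M₀]
    (N : ℕ → Type) [∀ m, AddCommGroup (N m)] [∀ m, Module (PowerSeries 𝒪) (N m)]
    [∀ m, Module.Finite (PowerSeries 𝒪) (N m)]
    (Q : ℕ → Type) [∀ m, AddCommGroup (Q m)] [∀ m, Module (PowerSeries 𝒪) (Q m)]
    (I : Ideal (PowerSeries 𝒪)) (hI : I ≤ (⊥ : Ideal (PowerSeries 𝒪)).jacobson)
    {L LS P π : PowerSeries 𝒪} (hπ : Prime π) (hL : ¬ π ∣ L) (hLS : LS = L * P) (hP : P ≠ 0)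
    (c : ℕ) (Lm : ℕ → PowerSeries 𝒪)
    (α : ∀ m : ℕ, 1 ≤ m → (MS →ₗ[PowerSeries 𝒪] Q m))
    (hα : ∀ (m : ℕ) (hm : 1 ≤ m), Function.Surjective (α m hm))
    (hD : ∀ m : ℕ, 1 ≤ m →
      Ideal.span {π ^ c} * Module.fittingIdeal (PowerSeries 𝒪) (Q m) 0 ≤
        Module.fittingIdeal (PowerSeries 𝒪) (N m) 0 ⊔ I ^ m)
    (hCh : ∀ m : ℕ, 1 ≤ m → Module.IsTorsion (PowerSeries 𝒪) (N m) →
      charIdeal (PowerSeries 𝒪) (N m) ≤ Ideal.span {Lm m})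
    (hc : ∀ m : ℕ, 1 ≤ m → Ideal.span {Lm m} ⊔ I ^ m = Ideal.span {LS} ⊔ I ^ m)
    (hTS : Module.IsTorsion (PowerSeries 𝒪) MS)
    (hnfS : ∀ N' : Submodule (PowerSeries 𝒪) MS, Module.length (PowerSeries 𝒪) N' ≠ ⊤ → N' = ⊥)
    (hT₀ : Module.IsTorsion (PowerSeries 𝒪) M₀)
    (hnf₀ : ∀ N' : Submodule (PowerSeries 𝒪) M₀, Module.length (PowerSeries 𝒪) N' ≠ ⊤ → N' = ⊥)
    (hSig : charIdeal (PowerSeries 𝒪) M₀ * Ideal.span {P} ≤ charIdeal (PowerSeries 𝒪) MS) :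
    charIdeal (PowerSeries 𝒪) M₀ ≤ Ideal.span {L} := by
  -- (1)–(4): the defect-tolerant limit at level Σ: `(π^c)·Fitt₀(X^Σ) ⊆ (L^Σ)`
  have hFitt : Ideal.span {π ^ c} * Module.fittingIdeal (PowerSeries 𝒪) MS 0 ≤ Ideal.span {LS} :=
    mul_fittingIdeal_le_span_of_congruences I (Ideal.span {π ^ c}) N Q Lm hI α hα hD
      (fun m hm => fittingIdeal_zero_le_of_charIdeal_le (hCh m hm)) hc
  -- (5): `Fitt₀ = Ch` at both levels, and `Ch(X)` is principal
  have hFCS : Module.fittingIdeal (PowerSeries 𝒪) MS 0 = charIdeal (PowerSeries 𝒪) MS :=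
    fittingIdeal_zero_eq_charIdeal_of_forall_length MS hTS hnfS
  have hFC₀ : Module.fittingIdeal (PowerSeries 𝒪) M₀ 0 = charIdeal (PowerSeries 𝒪) M₀ :=
    fittingIdeal_zero_eq_charIdeal_of_forall_length M₀ hT₀ hnf₀
  have hprinc : (Module.fittingIdeal (PowerSeries 𝒪) M₀ 0).IsPrincipal :=
    fittingIdeal_zero_isPrincipal_of_forall_length M₀ hT₀ hnf₀
  obtain ⟨f₀, hf₀⟩ := hprinc
  have hf₀' : charIdeal (PowerSeries 𝒪) M₀ = Ideal.span {f₀} := hFC₀ ▸ hf₀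
  -- (6): Σ-removal — `(π^c)·(f₀)·(P) ⊆ (L·P)`
  have h6 : Ideal.span {π ^ c} * (Ideal.span {f₀} * Ideal.span {P}) ≤ Ideal.span {L * P} := by
    rw [← hf₀', ← hLS]
    calc Ideal.span {π ^ c} * (charIdeal (PowerSeries 𝒪) M₀ * Ideal.span {P})
        ≤ Ideal.span {π ^ c} * charIdeal (PowerSeries 𝒪) MS := Ideal.mul_mono_right hSig
      _ = Ideal.span {π ^ c} * Module.fittingIdeal (PowerSeries 𝒪) MS 0 := by rw [hFCS]
      _ ≤ Ideal.span {LS} := hFitt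
  rw [Ideal.span_singleton_mul_span_singleton, Ideal.span_singleton_mul_span_singleton,
    Ideal.span_singleton_le_span_singleton] at h6
  -- cancel `P ≠ 0` in the domain `𝒪⟦T⟧`: `L ∣ π^c·f₀`
  have h7 : L ∣ π ^ c * f₀ := by
    obtain ⟨r, hr⟩ := h6
    refine ⟨r, mul_right_cancel₀ hP ?_⟩
    calc π ^ c * f₀ * P = π ^ c * (f₀ * P) := by ring
      _ = L * P * r := hr
      _ = L * r * P := by ring
  -- (8): cancellation by `μ(L) = 0`
  rw [hf₀', Ideal.span_singleton_le_span_singleton]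
  exact dvd_of_dvd_prime_pow_mul hπ hL c h7

/-- **At the trivial character, imprimitive road**: under the same inputs, for any generator `f_ac`
of `Ch_Λ(X)`, `ord L(0) ≤ ord f_ac(0)` (route p2's `IMCLowerAtTrivialChar` shape).
[cite: Castella2018Erratum, proof of Thm. 1.1 (p. 4), read one-sidedly and without (iv)] -/
theorem addVal_constantCoeff_le_of_congruences_defect_imprimitive
    {MS : Type} [AddCommGroup MS] [Module (PowerSeries 𝒪) MS] [Module.Finite (PowerSeries 𝒪) MS]
    {M₀ : Type} [AddCommGroup M₀] [Module (PowerSeries 𝒪) M₀] [Module.Finite (PowerSeries 𝒪) M₀]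
    (N : ℕ → Type) [∀ m, AddCommGroup (N m)] [∀ m, Module (PowerSeries 𝒪) (N m)]
    [∀ m, Module.Finite (PowerSeries 𝒪) (N m)]
    (Q : ℕ → Type) [∀ m, AddCommGroup (Q m)] [∀ m, Module (PowerSeries 𝒪) (Q m)]
    (I : Ideal (PowerSeries 𝒪)) (hI : I ≤ (⊥ : Ideal (PowerSeries 𝒪)).jacobson)
    {L LS P π : PowerSeries 𝒪} (hπ : Prime π) (hL : ¬ π ∣ L) (hLS : LS = L * P) (hP : P ≠ 0)
    (c : ℕ) (Lm : ℕ → PowerSeries 𝒪)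
    (α : ∀ m : ℕ, 1 ≤ m → (MS →ₗ[PowerSeries 𝒪] Q m))
    (hα : ∀ (m : ℕ) (hm : 1 ≤ m), Function.Surjective (α m hm))
    (hD : ∀ m : ℕ, 1 ≤ m →
      Ideal.span {π ^ c} * Module.fittingIdeal (PowerSeries 𝒪) (Q m) 0 ≤
        Module.fittingIdeal (PowerSeries 𝒪) (N m) 0 ⊔ I ^ m)
    (hCh : ∀ m : ℕ, 1 ≤ m → Module.IsTorsion (PowerSeries 𝒪) (N m) →
      charIdeal (PowerSeries 𝒪) (N m) ≤ Ideal.span {Lm m})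
    (hc : ∀ m : ℕ, 1 ≤ m → Ideal.span {Lm m} ⊔ I ^ m = Ideal.span {LS} ⊔ I ^ m)
    (hTS : Module.IsTorsion (PowerSeries 𝒪) MS)
    (hnfS : ∀ N' : Submodule (PowerSeries 𝒪) MS, Module.length (PowerSeries 𝒪) N' ≠ ⊤ → N' = ⊥)
    (hT₀ : Module.IsTorsion (PowerSeries 𝒪) M₀)
    (hnf₀ : ∀ N' : Submodule (PowerSeries 𝒪) M₀, Module.length (PowerSeries 𝒪) N' ≠ ⊤ → N' = ⊥)
    (hSig : charIdeal (PowerSeries 𝒪) M₀ * Ideal.span {P} ≤ charIdeal (PowerSeries 𝒪) MS)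
    {fac : PowerSeries 𝒪} (hfac : charIdeal (PowerSeries 𝒪) M₀ = Ideal.span {fac}) :
    addVal 𝒪 (constantCoeff L) ≤ addVal 𝒪 (constantCoeff fac) := by
  have h := charIdeal_le_span_of_congruences_defect_imprimitive N Q I hI hπ hL hLS hP c Lm α hα hD
    hCh hc hTS hnfS hT₀ hnf₀ hSig
  rw [hfac] at h
  exact addVal_constantCoeff_le_of_span_le h

end EndFormSigma

/-! ### §4 (7′) assembled: the PRIMITIVE `μ = 0` from the printed data at ONE level -/

section Assembled

variable {𝒪 : Type} [CommRing 𝒪] [IsDomain 𝒪]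

/-- **STEP (7′) ASSEMBLED over `Λ = 𝒪⟦T⟧`** (memo §33). Data at ONE level `m`: the printed (c) as an
ideal equality modulo `J ⊆ (ϖ^{t+1})` between `L^Σ(g_m) = L(g_m)·C(g_m)·∏_{w ∈ S} P_w(g_m)` and
`L^Σ(f) = L(f)·C(f)·∏_{w ∈ S} P_w(f)` [Cas18 (3.1)]; ramified constants `C(g_m) = ϖ^t·u`, `u` a
`ϖ`-unit, `ϖ^t ∣ C(f)` (both `= ∏_𝔮 (1 + q⁻¹)` by footnote 1 of the erratum); split Euler factors
`P_w(g_m) = Q_w(z_w)` with `ϖ ∤ Q_w(0)` (`Q_w(0) = 1`) and `z_w` non-constant modulo `ϖ` (`γ_w ≠ 1`);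
and `ϖ ∤ L(g_m)` [Hsi14, Thm. B]. THEN `ϖ ∤ L(f)`: `μ(L_𝔭(f)) = 0`, the input `hL` of §3 and of
`BoundedCongruenceLimit.charIdeal_le_span_of_congruences_defect`. Pure algebra; CONDITIONAL on
nothing. [cite: Castella2018Erratum, proof of Thm. 1.1, (c) and footnote 1 (p. 4)] [cite: Castella2018, (3.1)]
[cite: Hsieh2014, Thm. B] -/
theorem not_C_dvd_of_printed_congruence {ϖ : 𝒪} (hϖ : Prime ϖ)
    {L Lm C Cm u : PowerSeries 𝒪} {t : ℕ} {J : Ideal (PowerSeries 𝒪)}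
    {ι : Type*} (S : Finset ι) (P Qm : ι → Polynomial 𝒪) (z zm : ι → PowerSeries 𝒪)
    (hc : Ideal.span {Lm * Cm * ∏ i ∈ S, Polynomial.aeval (zm i) (Qm i)} ⊔ J =
      Ideal.span {L * C * ∏ i ∈ S, Polynomial.aeval (z i) (P i)} ⊔ J)
    (hJ : J ≤ Ideal.span {PowerSeries.C ϖ ^ (t + 1)})
    (hCm : Cm = PowerSeries.C ϖ ^ t * u) (hu : ¬ PowerSeries.C ϖ ∣ u) (hC : PowerSeries.C ϖ ^ t ∣ C)
    (hQ : ∀ i ∈ S, ¬ ϖ ∣ (Qm i).coeff 0)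
    (hz : ∀ i ∈ S, PowerSeries.map (Ideal.Quotient.mk (Ideal.span {ϖ})) (zm i) ≠
      PowerSeries.C (PowerSeries.constantCoeff
        (PowerSeries.map (Ideal.Quotient.mk (Ideal.span {ϖ})) (zm i))))
    (hLm : ¬ PowerSeries.C ϖ ∣ Lm) :
    ¬ PowerSeries.C ϖ ∣ L := by
  have hπ : Prime (PowerSeries.C ϖ : PowerSeries 𝒪) := prime_C_of_prime hϖ
  refine not_dvd_of_imprimitive_congruence_eq hπ hc hJ (dvd_refl _) hCm hu hC hLm ?_
  exact hπ.not_dvd_finsetProd fun i hi => not_C_dvd_aeval hϖ (hQ i hi) (hz i hi)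

end Assembled

end Summit.BirchSwinnertonDyer.BirchSwinnertonDyer.Theorems.MuTransfer

end
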